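import Mathlib
import HarnessLib
import Summits.Ventures.LatticeQCDFlow.Exactness.NCMCGeneralSpaceReplicaTStatisticQuantile

/-!
# The calibrating quantile is UNIQUE: `q ↦ L_R(q)` is strictly increasing on `[0, ∞)`

HONEST FRAMING: exact (Metropolis-corrected) sampling algorithms for lattice gauge theory;
figures of merit are autocorrelation/cost numbers at stated couplings and volumes; no
continuum-physics claim.

Venture `LatticeQCDFlow` (cell pub-lqcd), topic `Exactness`; FANOUT row 13 (`eng-snf`, GEN-23, replica
pooling).  NEW WORK of the cell against Mathlib (`gaussianPDF_pos`, `setLIntegral_pos_iff`,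
`Measure.pi.isOpenPosMeasure`) and the cell's `NCMCGeneralSpaceReplicaTStatistic*` files; not a
published result; no definition is introduced; nothing is cited as a fact.

WHY (row 13).  `NCMCGeneralSpaceReplicaTStatisticQuantile` shows a calibrating quantile `q` with
`L_R(q) = 1 − α` EXISTS; typed here: it is UNIQUE, because the law of `t(Z)` charges every interval —
a non-degenerate Gaussian charges every non-empty open set, hence so does the product Gaussian, and
`t` is continuous off the diagonal and takes every real value there (shift `z ↦ z + λ·1` moves `t`
affinely at fixed spread).

## Content
* `isOpenPosMeasure_gaussianReal` — `N(m, v)`, `v ≠ 0`, charges every non-empty open set.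
* `continuousAt_tStat_pi` — `t` is continuous off the diagonal on `ι → ℝ`.
* **`pi_gaussianReal_measure_tStat_Ioo_pos`** — `N(0,1)^{⊗R}{q < t < q'} > 0` for all `q < q'` (`R ≥ 2`).
* **`pi_gaussianReal_measure_abs_tStat_le_lt`** — `0 ≤ q < q'` ⇒ `L_R(q) < L_R(q')`;
  **`replicaT_calibrating_quantile_unique`** — two calibrating quantiles of the same level coincide.

NOT CLAIMED: the value of the quantile; anything numerical.
-/

namespace Summit.Ventures.LatticeQCDFlow.Exactness.GeneralNCMC

open MeasureTheory ProbabilityTheory Filter Set Function Finset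
open scoped ENNReal NNReal Topology

section OpenPos

/-- **A non-degenerate Gaussian charges every non-empty open set.** -/
theorem isOpenPosMeasure_gaussianReal (m : ℝ) {v : ℝ≥0} (hv : v ≠ 0) :
    (gaussianReal m v).IsOpenPosMeasure := by
  refine ⟨fun U hU hne => ?_⟩
  rw [gaussianReal_of_var_ne_zero _ hv, withDensity_apply _ hU.measurableSet]
  have hsupp : support (gaussianPDF m v) = Set.univ :=
    Set.eq_univ_of_forall fun x => (gaussianPDF_pos m hv x).ne'
  have h : 0 < ∫⁻ x in U, gaussianPDF m v x ∂volume := by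
    rw [setLIntegral_pos_iff (measurable_gaussianPDF m v), hsupp, Set.univ_inter]
    exact hU.measure_pos volume hne
  exact h.ne'

end OpenPos

section TStat

variable {ι : Type*} [Fintype ι] [Nontrivial ι]

/-- `t` is continuous off the diagonal, on `ι → ℝ`. -/
theorem continuousAt_tStat_pi {x : ι → ℝ}
    (hx : (∑ r, (x r - (∑ r', x r') / (Fintype.card ι : ℝ)) ^ 2) ≠ 0) :
    ContinuousAt (fun z : ι → ℝ =>
      (∑ r, z r) / Fintype.card ι
        / Real.sqrt ((∑ r, (z r - (∑ r', z r') / Fintype.card ι) ^ 2)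
            / ((Fintype.card ι : ℝ) * (Fintype.card ι - 1)))) x := by
  have hc : ∀ r : ι, Continuous fun z : ι → ℝ => z r := fun r => continuous_apply r
  have hnum : Continuous fun z : ι → ℝ => (∑ r, z r) / (Fintype.card ι : ℝ) := by fun_prop
  have hden : Continuous fun z : ι → ℝ => Real.sqrt ((∑ r, (z r - (∑ r', z r')
      / (Fintype.card ι : ℝ)) ^ 2) / ((Fintype.card ι : ℝ) * (Fintype.card ι - 1))) := by
    fun_prop
  refine hnum.continuousAt.div hden.continuousAt ?_
  have hR : (1 : ℝ) < Fintype.card ι := by exact_mod_cast Fintype.one_lt_card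
  have hpos : 0 < (∑ r, (x r - (∑ r', x r') / (Fintype.card ι : ℝ)) ^ 2)
      / ((Fintype.card ι : ℝ) * (Fintype.card ι - 1)) :=
    div_pos (lt_of_le_of_ne (sum_nonneg fun r _ => sq_nonneg _) (Ne.symm hx))
      (mul_pos (by linarith) (by linarith))
  exact (Real.sqrt_pos.2 hpos).ne'

/-- Shifting all coordinates by `λ` moves the mean by `λ`. -/
theorem mean_add_const (z : ι → ℝ) (c : ℝ) :
    (∑ r, (z r + c)) / (Fintype.card ι : ℝ) = (∑ r, z r) / (Fintype.card ι : ℝ) + c := by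
  have hR : (Fintype.card ι : ℝ) ≠ 0 := Nat.cast_ne_zero.2 Fintype.card_ne_zero
  rw [sum_add_distrib, sum_const, card_univ, nsmul_eq_mul, add_div, mul_div_cancel_left₀ c hR]

/-- Shifting all coordinates leaves the sum of squared deviations unchanged. -/
theorem sumSqDev_add_const (z : ι → ℝ) (c : ℝ) :
    ∑ r, ((z r + c) - (∑ r', (z r' + c)) / (Fintype.card ι : ℝ)) ^ 2
      = ∑ r, (z r - (∑ r', z r') / (Fintype.card ι : ℝ)) ^ 2 := by
  rw [mean_add_const]
  refine sum_congr rfl fun r _ => ?_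
  ring

/-- **`t` takes every real value off the diagonal, continuously: `N(0,1)^{⊗R}{q < t < q'} > 0`**
(`q < q'`, `R ≥ 2`). -/
theorem pi_gaussianReal_measure_tStat_Ioo_pos {q q' : ℝ} (hqq' : q < q') :
    0 < (Measure.pi fun _ : ι => gaussianReal 0 1) {z : ι → ℝ |
      (∑ r, z r) / Fintype.card ι
        / Real.sqrt ((∑ r, (z r - (∑ r', z r') / Fintype.card ι) ^ 2)
            / ((Fintype.card ι : ℝ) * (Fintype.card ι - 1))) ∈ Set.Ioo q q'} := by
  classical
  haveI : ∀ _r : ι, (gaussianReal 0 (1 : ℝ≥0)).IsOpenPosMeasure :=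
    fun _ => isOpenPosMeasure_gaussianReal 0 one_ne_zero
  obtain ⟨r₀, s₁, hne⟩ := exists_pair_ne ι
  -- a vector off the diagonal
  set e : ι → ℝ := update 0 r₀ 1 with he
  have hSSD : (∑ r, (e r - (∑ r', e r') / (Fintype.card ι : ℝ)) ^ 2) ≠ 0 := by
    intro h0
    have := eval_eq_eval_of_sumSqDev_eq_zero e h0 r₀ s₁
    simp [he, hne.symm] at this
  have hR1 : (1 : ℝ) < Fintype.card ι := by exact_mod_cast Fintype.one_lt_card
  set g : ℝ := Real.sqrt ((∑ r, (e r - (∑ r', e r') / (Fintype.card ι : ℝ)) ^ 2)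
      / ((Fintype.card ι : ℝ) * (Fintype.card ι - 1))) with hg
  have hgpos : 0 < g := Real.sqrt_pos.2 (div_pos
    (lt_of_le_of_ne (sum_nonneg fun r _ => sq_nonneg _) (Ne.symm hSSD))
    (mul_pos (by linarith) (by linarith)))
  -- shift so that `t = τ := (q + q')/2`
  set τ : ℝ := (q + q') / 2 with hτ
  set c : ℝ := τ * g - (∑ r, e r) / (Fintype.card ι : ℝ) with hc
  set z₀ : ι → ℝ := fun r => e r + c with hz₀
  have hSSD₀ : (∑ r, (z₀ r - (∑ r', z₀ r') / (Fintype.card ι : ℝ)) ^ 2)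
      = ∑ r, (e r - (∑ r', e r') / (Fintype.card ι : ℝ)) ^ 2 := sumSqDev_add_const e c
  have ht₀ : (∑ r, z₀ r) / Fintype.card ι
        / Real.sqrt ((∑ r, (z₀ r - (∑ r', z₀ r') / Fintype.card ι) ^ 2)
            / ((Fintype.card ι : ℝ) * (Fintype.card ι - 1))) = τ := by
    rw [hSSD₀, ← hg, show (∑ r, z₀ r) / (Fintype.card ι : ℝ) = (∑ r, e r) / (Fintype.card ι : ℝ) + c
      from mean_add_const e c, hc, add_sub_cancel, mul_div_cancel_right₀ τ hgpos.ne']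
  -- the preimage of `Ioo q q'` is a neighbourhood of `z₀`
  have hcont : ContinuousAt (fun z : ι → ℝ =>
      (∑ r, z r) / Fintype.card ι
        / Real.sqrt ((∑ r, (z r - (∑ r', z r') / Fintype.card ι) ^ 2)
            / ((Fintype.card ι : ℝ) * (Fintype.card ι - 1)))) z₀ :=
    continuousAt_tStat_pi (by rw [hSSD₀]; exact hSSD)
  have hmem : Set.Ioo q q' ∈ 𝓝 ((∑ r, z₀ r) / Fintype.card ι
        / Real.sqrt ((∑ r, (z₀ r - (∑ r', z₀ r') / Fintype.card ι) ^ 2)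
            / ((Fintype.card ι : ℝ) * (Fintype.card ι - 1)))) := by
    rw [ht₀]
    exact Ioo_mem_nhds (by rw [hτ]; linarith) (by rw [hτ]; linarith)
  have hnhds := hcont.preimage_mem_nhds hmem
  obtain ⟨U, hUsub, hUo, hz₀U⟩ := mem_nhds_iff.1 hnhds
  exact lt_of_lt_of_le (hUo.measure_pos _ ⟨z₀, hz₀U⟩) (measure_mono hUsub)

/-- **`L_R` IS STRICTLY INCREASING ON `[0, ∞)`**: `0 ≤ q < q'` ⇒
`N(0,1)^{⊗R}{|t| ≤ q} < N(0,1)^{⊗R}{|t| ≤ q'}`. -/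
theorem pi_gaussianReal_measure_abs_tStat_le_lt {q q' : ℝ} (hq : 0 ≤ q) (hqq' : q < q') :
    (Measure.pi fun _ : ι => gaussianReal 0 1) {z : ι → ℝ | |(∑ r, z r) / Fintype.card ι
        / Real.sqrt ((∑ r, (z r - (∑ r', z r') / Fintype.card ι) ^ 2)
            / ((Fintype.card ι : ℝ) * (Fintype.card ι - 1)))| ≤ q}
      < (Measure.pi fun _ : ι => gaussianReal 0 1) {z : ι → ℝ | |(∑ r, z r) / Fintype.card ι
        / Real.sqrt ((∑ r, (z r - (∑ r', z r') / Fintype.card ι) ^ 2)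
            / ((Fintype.card ι : ℝ) * (Fintype.card ι - 1)))| ≤ q'} := by
  set μ := Measure.pi fun _ : ι => gaussianReal 0 (1 : ℝ≥0) with hμ
  set t : (ι → ℝ) → ℝ := fun z => (∑ r, z r) / Fintype.card ι
        / Real.sqrt ((∑ r, (z r - (∑ r', z r') / Fintype.card ι) ^ 2)
            / ((Fintype.card ι : ℝ) * (Fintype.card ι - 1))) with ht
  have hpos : 0 < μ {z | t z ∈ Set.Ioo q q'} := pi_gaussianReal_measure_tStat_Ioo_pos hqq'
  have hdisj : Disjoint {z : ι → ℝ | |t z| ≤ q} {z | t z ∈ Set.Ioo q q'} := by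
    rw [Set.disjoint_left]
    intro z hz hz'
    simp only [Set.mem_setOf_eq, Set.mem_Ioo, abs_le] at hz hz'
    linarith [hz.2, hz'.1]
  have hsub : {z : ι → ℝ | |t z| ≤ q} ∪ {z | t z ∈ Set.Ioo q q'} ⊆ {z | |t z| ≤ q'} := by
    intro z hz
    simp only [Set.mem_union, Set.mem_setOf_eq, Set.mem_Ioo, abs_le] at hz ⊢
    rcases hz with hz | hz
    · constructor <;> linarith [hz.1, hz.2]
    · constructor <;> linarith [hz.1, hz.2]
  have hmeasI : MeasurableSet {z : ι → ℝ | t z ∈ Set.Ioo q q'} :=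
    measurable_tStat_pi measurableSet_Ioo
  calc μ {z | |t z| ≤ q} < μ {z | |t z| ≤ q} + μ {z | t z ∈ Set.Ioo q q'} :=
        ENNReal.lt_add_right (measure_ne_top _ _) hpos.ne'
    _ = μ ({z | |t z| ≤ q} ∪ {z | t z ∈ Set.Ioo q q'}) := (measure_union hdisj hmeasI).symm
    _ ≤ μ {z | |t z| ≤ q'} := measure_mono hsub

/-- **THE CALIBRATING QUANTILE IS UNIQUE**: if `0 ≤ q, q'` and `L_R(q) = L_R(q')` then `q = q'`. -/
theorem replicaT_calibrating_quantile_unique {q q' : ℝ} (hq : 0 ≤ q) (hq' : 0 ≤ q')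
    (h : (Measure.pi fun _ : ι => gaussianReal 0 1) {z : ι → ℝ | |(∑ r, z r) / Fintype.card ι
        / Real.sqrt ((∑ r, (z r - (∑ r', z r') / Fintype.card ι) ^ 2)
            / ((Fintype.card ι : ℝ) * (Fintype.card ι - 1)))| ≤ q}
      = (Measure.pi fun _ : ι => gaussianReal 0 1) {z : ι → ℝ | |(∑ r, z r) / Fintype.card ι
        / Real.sqrt ((∑ r, (z r - (∑ r', z r') / Fintype.card ι) ^ 2)
            / ((Fintype.card ι : ℝ) * (Fintype.card ι - 1)))| ≤ q'}) :
    q = q' := by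
  by_contra hne
  rcases lt_or_gt_of_ne hne with hlt | hlt
  · exact (ne_of_lt (pi_gaussianReal_measure_abs_tStat_le_lt (ι := ι) hq hlt)) h
  · exact (ne_of_lt (pi_gaussianReal_measure_abs_tStat_le_lt (ι := ι) hq' hlt)) h.symm

end TStat

end Summit.Ventures.LatticeQCDFlow.Exactness.GeneralNCMC
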